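import Summits.AtomisticToContinuum.HydrodynamicLimit.Theses.AntiMazurCoboundaries
import Literature.MathematicalPhysics.KineticTheory.HardSphereEulerProofs
import Literature.MathematicalPhysics.KineticTheory.HardBallErgodicity

/-!
# Stub `stub_shellMeanBound` of line `almost-invariant-duality` — crux `AntiMazurCoboundaries.CorrectorPressureDecay`
(stmt-AtomisticToContinuum-14135)

Helper file (`--supports stmt-AtomisticToContinuum-14135`) proving the registered stub `stub_shellMeanBound` of the lead's skeleton
`Cruxes/CorrectorPressureDecay/Lines/almost-invariant-duality.lean` (the statement is spelled over tree primitives exactly as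
registered): the PLUMBING `GaussianShellMarginal → MaxwellianSecondOrder → ShellMeanBound`. Proof summary:
* `exists_posLaw_integral_mul` — product structure of the constant-profile Gibbs law `G_N` (`σ ≤ 1/2`): by the tree
  disintegration `lintegral_localGibbsMeasure` and `lintegral_posWeight_eq_one`, `G_N` is the image of `μ ⊗ (⊗ᵢ N(u₀, θ))` under
  `zipConfig` for a probability measure `μ` on the positions, and `⊗ᵢ N(u₀, θ)` is the image of `γ = ⊗ᵢ γ₃` under
  `wᵢ ↦ u₀ + √θ wᵢ` (`Measure.pi_map_pi`); hence `∫ f(x) H(v) dG_N = (∫ f dμ) ∫ H(u₀ + √θ w) dγ`.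
* In the reduced velocities the fast observable `F = ∑ᵢ φ(xᵢ) g(ṽᵢ)` tested against `B(P, E)` integrates to
  `∑ᵢ cᵢ Jᵢ`, `cᵢ = ∫ φ(xᵢ) dμ ∈ [-1, 1]`, `Jᵢ = ∫ g(wᵢ) B̃(∑w, ∑‖w‖²) dγ`, and `Jᵢ = J₀` by relabelling invariance of `γ`
  (`integral_comp_perm_pi_stdGaussian`); the shell distance `ω` becomes `ω̃(w) = min 1 (‖n⁻¹∑wᵢ‖² + (n⁻¹∑‖wᵢ‖²/3 - 1)²)` exactly.
* Hypothesis 1 (Gaussian shell marginal) with `h = g/κ` replaces `g(w₀)` in `J₀` by the Maxwellian average `M_g` at cost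
  `κ C₁/(N+1) ∫ B̃ dγ`; hypothesis 2 (Maxwellian second order, at `s = θ̂' ≥ 0` by Jensen `norm_sq_mean_le`) and the elementary
  comparison `min_shell_le` give `|M_g| ≤ 3 κ C₂ ω̃`; summing over `i` yields the claim with `C₀ = 3 C₂ + C₁`.
-/

noncomputable section

open MeasureTheory ProbabilityTheory Set Filter Topology
open scoped ENNReal

namespace Summit.AtomisticToContinuum.HydrodynamicLimit.Theorems.AlmostInvariantDuality

open Literature.MathematicalPhysics.KineticTheory (T3 V3 hsDiameter localGibbsLaw)
open Literature.Analysis.FluidPDE (HardSphereFlow Config configMomentum configEnergy)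
open Summit.AtomisticToContinuum.HydrodynamicLimit.Theses.AntiMazurCoboundaries (CorrectorPressureDecay)

/-! ## Product structure of the constant-profile Gibbs law -/

section Transfer

open Literature.MathematicalPhysics.KineticTheory

/-- **Product structure of the constant-profile Gibbs law** (`σ ≤ 1/2`): there is a probability measure `μ` on the positions
(the configurational Gibbs law) such that `∫ f(x) H(v) dG_N = (∫ f dμ) · ∫ H(u₀ + √θ w) d(⊗ᵢ γ₃)` for every `f` and every
measurable `H`; in particular velocity functionals integrate under `G_N` as under `⊗ᵢ N(u₀, θ)`. -/
theorem exists_posLaw_integral_mul {a θ : ℝ} (ha : 0 < a) (hθ : 0 < θ) (u₀ : V3) {σ : ℝ} (hσ2 : σ ≤ 1 / 2) (N : ℕ) :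
    ∃ μ : Measure (Fin (N + 1) → T3), IsProbabilityMeasure μ ∧
      (∀ (f : (Fin (N + 1) → T3) → ℝ) {H : (Fin (N + 1) → V3) → ℝ}, Measurable H →
        ∫ z, f (fun i => (z i).1) * H (fun i => (z i).2) ∂(localGibbsMeasure σ (fun _ => a) (fun _ => u₀) (fun _ => θ) N) =
          (∫ x, f x ∂μ) * ∫ w, H (fun i => u₀ + Real.sqrt θ • w i) ∂(Measure.pi fun _ : Fin (N + 1) => stdGaussian V3)) ∧
      ∀ {H : (Fin (N + 1) → V3) → ℝ}, Measurable H →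
        ∫ z, H (fun i => (z i).2) ∂(localGibbsMeasure σ (fun _ => a) (fun _ => u₀) (fun _ => θ) N) =
          ∫ w, H (fun i => u₀ + Real.sqrt θ • w i) ∂(Measure.pi fun _ : Fin (N + 1) => stdGaussian V3) := by
  haveI := isProbabilityMeasure_localGibbsMeasure (a₀ := fun _ => a) (u₀ := fun _ => u₀) (θ₀ := fun _ => θ)
    continuous_const continuous_const continuous_const (fun _ => ha) (fun _ => hθ) hσ2 N
  set ρ : (Fin (N + 1) → T3) → ℝ≥0∞ := fun x => ENNReal.ofReal
      ((Literature.Analysis.FluidPDE.canonicalPartition (Literature.Analysis.FluidPDE.Torus.geometry (Fin 3)) (hsDiameter σ N) (N + 1)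
        (localGibbsProfile (fun _ => a) (fun _ => u₀) (fun _ => θ)))⁻¹ * posWeight (fun _ => a) (hsDiameter σ N) (N + 1) x) with hρ
  have hρm : Measurable ρ := (measurable_const.mul (measurable_posWeight continuous_const _ _)).ennreal_ofReal
  set V : Measure (Fin (N + 1) → V3) := Measure.pi fun _ : Fin (N + 1) => gaussMeasure u₀ θ with hV
  -- the measure identity `G_N = (μ ⊗ V) ∘ zipConfig⁻¹`, tested against measurable `G ≥ 0`
  have hGeq : localGibbsMeasure σ (fun _ => a) (fun _ => u₀) (fun _ => θ) N = ((volume.withDensity ρ).prod V).map zipConfig := by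
    refine Measure.ext_of_lintegral _ fun G hG => ?_
    have hin : Measurable fun x : Fin (N + 1) → T3 => ∫⁻ v, G (zipConfig (x, v)) ∂V :=
      (hG.comp measurable_zipConfig).lintegral_prod_right'
    rw [lintegral_localGibbsMeasure continuous_const continuous_const continuous_const (fun _ => ha.le) (fun _ => hθ) σ N hG,
      lintegral_map hG measurable_zipConfig, lintegral_prod (fun p => G (zipConfig p)) (hG.comp measurable_zipConfig).aemeasurable,
      lintegral_withDensity_eq_lintegral_mul _ hρm hin]
    rfl
  have hT : Measurable fun (w : Fin (N + 1) → V3) (i : Fin (N + 1)) => u₀ + Real.sqrt θ • w i :=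
    measurable_pi_lambda _ fun i => (measurable_gaussShift u₀ θ).comp (measurable_pi_apply i)
  have hVeq : V = (Measure.pi fun _ : Fin (N + 1) => stdGaussian V3).map (fun w i => u₀ + Real.sqrt θ • w i) := by
    rw [hV, Measure.pi_map_pi (fun _ => (measurable_gaussShift u₀ θ).aemeasurable)]
    rfl
  have hprod : ∀ (f : (Fin (N + 1) → T3) → ℝ) {H : (Fin (N + 1) → V3) → ℝ}, Measurable H →
      ∫ z, f (fun i => (z i).1) * H (fun i => (z i).2) ∂(localGibbsMeasure σ (fun _ => a) (fun _ => u₀) (fun _ => θ) N) =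
        (∫ x, f x ∂(volume.withDensity ρ)) *
          ∫ w, H (fun i => u₀ + Real.sqrt θ • w i) ∂(Measure.pi fun _ : Fin (N + 1) => stdGaussian V3) := by
    intro f H hH
    rw [hGeq, show (zipConfig : (Fin (N + 1) → T3) × (Fin (N + 1) → V3) → Config (N + 1) (Fin 3) T3) =
        ⇑(MeasurableEquiv.arrowProdEquivProdArrow T3 V3 (Fin (N + 1))).symm from rfl, integral_map_equiv]
    show ∫ p : (Fin (N + 1) → T3) × (Fin (N + 1) → V3), f p.1 * H p.2 ∂_ = _
    rw [integral_prod_mul, hVeq, integral_map hT.aemeasurable hH.aestronglyMeasurable]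
  have hone : ∫⁻ x, ρ x = 1 :=
    lintegral_posWeight_eq_one continuous_const continuous_const continuous_const (fun _ => ha.le) (fun _ => hθ) σ N
  haveI hμ : IsProbabilityMeasure (volume.withDensity ρ) :=
    ⟨by rw [withDensity_apply _ MeasurableSet.univ, Measure.restrict_univ, hone]⟩
  refine ⟨volume.withDensity ρ, hμ, hprod, fun {H} hH => ?_⟩
  have h := hprod (fun _ => 1) hH
  simp only [one_mul, integral_const, smul_eq_mul, mul_one, probReal_univ] at h
  exact h

end Transfer

/-! ## Elementary tools -/

/-- The product Gaussian `⊗ᵢ γ₃` is invariant under relabelling the factors. -/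
theorem integral_comp_perm_pi_stdGaussian {n : ℕ} (e : Equiv.Perm (Fin n)) (F : (Fin n → V3) → ℝ) :
    ∫ w, F (fun j => w (e j)) ∂(Measure.pi fun _ : Fin n => stdGaussian V3) =
      ∫ w, F w ∂(Measure.pi fun _ : Fin n => stdGaussian V3) :=
  (measurePreserving_arrowCongr' (fun _ : Fin n => stdGaussian V3) (fun _ => stdGaussian V3) e.symm
    (MeasurableEquiv.refl V3) (fun _ => MeasurePreserving.id _)).integral_comp' F

/-- Products of bounded measurable real functions are integrable under a finite measure. -/
theorem integrable_mul_of_abs_le {α : Type*} [MeasurableSpace α] {μ : Measure α} [IsFiniteMeasure μ] {f g : α → ℝ}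
    (hf : Measurable f) (hg : Measurable g) {Cf Cg : ℝ} (hfC : ∀ x, |f x| ≤ Cf) (hgC : ∀ x, |g x| ≤ Cg) :
    Integrable (fun x => f x * g x) μ :=
  Integrable.of_bound (hf.mul hg).aestronglyMeasurable (Cf * Cg) (ae_of_all _ fun x => by
    rw [Real.norm_eq_abs, abs_mul]
    exact mul_le_mul (hfC x) (hgC x) (abs_nonneg _) ((abs_nonneg _).trans (hfC x)))

/-- The elementary comparison of the two shell deviation functionals: with `x = ‖p̂‖² ≥ 0`, `e = ê` and the reduced
temperature `θ̂' = (e - x)/3`, `min 1 (x + (θ̂' - 1)²) ≤ 3 min 1 (x + (e/3 - 1)²)`. -/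
theorem min_shell_le {x e : ℝ} (hx : 0 ≤ x) :
    min 1 (x + ((e - x) / 3 - 1) ^ 2) ≤ 3 * min 1 (x + (e / 3 - 1) ^ 2) := by
  rcases le_or_gt 1 (x + (e / 3 - 1) ^ 2) with hc | hc
  · rw [min_eq_left hc]
    linarith [min_le_left 1 (x + ((e - x) / 3 - 1) ^ 2)]
  · rw [min_eq_right hc.le]
    refine (min_le_right _ _).trans ?_
    nlinarith [sq_nonneg (e / 3 - 1 + x / 6), mul_nonneg hx (sub_nonneg.2 hc.le), mul_nonneg hx (sq_nonneg (e / 3 - 1))]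

/-- Jensen / Cauchy–Schwarz for the empirical mean: `‖n⁻¹ ∑ wᵢ‖² ≤ n⁻¹ ∑ ‖wᵢ‖²` (so the reduced temperature is `≥ 0`). -/
theorem norm_sq_mean_le {N : ℕ} (w : Fin (N + 1) → V3) :
    ‖((N : ℝ) + 1)⁻¹ • ∑ i, w i‖ ^ 2 ≤ ((N : ℝ) + 1)⁻¹ * ∑ i, ‖w i‖ ^ 2 := by
  have hn : (0 : ℝ) < (N : ℝ) + 1 := by positivity
  have h1 : ‖∑ i, w i‖ ^ 2 ≤ ((N : ℝ) + 1) * ∑ i, ‖w i‖ ^ 2 := by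
    calc ‖∑ i, w i‖ ^ 2 ≤ (∑ i, ‖w i‖) ^ 2 := pow_le_pow_left₀ (norm_nonneg _) (norm_sum_le _ _) 2
      _ ≤ (Finset.univ : Finset (Fin (N + 1))).card * ∑ i, ‖w i‖ ^ 2 := sq_sum_le_card_mul_sum_sq
      _ = ((N : ℝ) + 1) * ∑ i, ‖w i‖ ^ 2 := by rw [Finset.card_univ, Fintype.card_fin]; push_cast; ring
  rw [norm_smul, mul_pow, Real.norm_eq_abs, abs_of_pos (inv_pos.2 hn)]
  calc ((N : ℝ) + 1)⁻¹ ^ 2 * ‖∑ i, w i‖ ^ 2 ≤ ((N : ℝ) + 1)⁻¹ ^ 2 * (((N : ℝ) + 1) * ∑ i, ‖w i‖ ^ 2) :=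
        mul_le_mul_of_nonneg_left h1 (by positivity)
    _ = ((N : ℝ) + 1)⁻¹ * ∑ i, ‖w i‖ ^ 2 := by field_simp

attribute [local fun_prop] Literature.MathematicalPhysics.KineticTheory.continuous_configMomentum
  Literature.MathematicalPhysics.KineticTheory.continuous_configEnergy

/-! ## The stub -/

/-- STUB 3b of line `almost-invariant-duality` (**shell mean bound**, PLUMBING
`GaussianShellMarginal → MaxwellianSecondOrder → ShellMeanBound`): under the constant-profile local Gibbs law `G_N`
(`0 < σ ≤ 1/2`, `a, θ > 0`) the fast observable `F = ∑ᵢ φ(xᵢ) g(ṽᵢ)` (`|φ| ≤ 1`, `|g| ≤ κ`, `g ⟂ 1, v, ‖v‖²` in `L²(γ₃)`,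
`ṽᵢ = (vᵢ - u₀)/√θ`) tested against any bounded measurable `B(P, E) ≥ 0` is bounded by `κ C₀ ∫ ((N+1) ω + 1) B(P, E) dG_N`,
`ω` the reduced shell distance. Proof: `G_N` disintegrates into positions × i.i.d. `N(u₀, θ)` velocities
(`exists_posLaw_integral_mul`), so `∫ F B dG_N = ∑ᵢ cᵢ Jᵢ` with `|cᵢ| ≤ 1` and `Jᵢ = ∫ g(wᵢ) B̃(∑w, ∑‖w‖²) d⊗γ₃ = J₀`
(relabelling); the first hypothesis with `h = g/κ` replaces `g(w₀)` by the Maxwellian average `M_g` at cost `κ C₁/(N+1) ∫ B̃`,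
the second (at the reduced temperature `θ̂' ≥ 0`, `norm_sq_mean_le`) and `min_shell_le` give `|M_g| ≤ 3 κ C₂ ω̃`; hence
`C₀ = 3 C₂ + C₁`. -/
theorem stub_shellMeanBound :
    (∃ C₁ : ℝ, 0 ≤ C₁ ∧ ∀ (N : ℕ) (h : V3 → ℝ), Measurable h → (∀ v, |h v| ≤ 1) →
      ∀ B : V3 → ℝ → ℝ, Measurable (fun p : V3 × ℝ => B p.1 p.2) → (∀ p t, 0 ≤ B p t) →
        (∃ C : ℝ, ∀ p t, B p t ≤ C) →
        |∫ w, (h (w 0) -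
              (∫ u, h ((((N : ℝ) + 1))⁻¹ • (∑ i, w i) +
                Real.sqrt (((((N : ℝ) + 1))⁻¹ * (∑ i, ‖w i‖ ^ 2) - ‖(((N : ℝ) + 1))⁻¹ • (∑ i, w i)‖ ^ 2) / 3) • u)
                ∂(stdGaussian V3))) *
              B (∑ i, w i) (∑ i, ‖w i‖ ^ 2) ∂(Measure.pi fun _ : Fin (N + 1) => stdGaussian V3)| ≤
          C₁ / ((N : ℝ) + 1) * ∫ w, B (∑ i, w i) (∑ i, ‖w i‖ ^ 2) ∂(Measure.pi fun _ : Fin (N + 1) => stdGaussian V3)) →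
    (∃ C₂ : ℝ, 1 ≤ C₂ ∧ ∀ (κ : ℝ) (g : V3 → ℝ), Continuous g → (∀ v, |g v| ≤ κ) →
      (∀ (c₀ c₂ : ℝ) (b : V3),
        ∫ v, g v * (c₀ + inner ℝ b v + c₂ * ‖v‖ ^ 2) ∂(stdGaussian V3) = 0) →
      ∀ (p : V3) (s : ℝ), 0 ≤ s →
        |∫ u, g (p + Real.sqrt s • u) ∂(stdGaussian V3)| ≤
          κ * C₂ * min 1 (‖p‖ ^ 2 + (s - 1) ^ 2)) →
    ∃ C₀ : ℝ, 1 ≤ C₀ ∧ ∀ (σ a θ : ℝ) (u₀ : V3), 0 < σ → σ ≤ 1 / 2 → 0 < a → 0 < θ →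
      ∀ (κ : ℝ) (φ : T3 → ℝ) (g : V3 → ℝ), Continuous φ → Continuous g → (∀ x, |φ x| ≤ 1) →
        (∀ v, |g v| ≤ κ) →
        (∀ (c₀ c₂ : ℝ) (b : V3),
          ∫ v, g v * (c₀ + inner ℝ b v + c₂ * ‖v‖ ^ 2) ∂(stdGaussian V3) = 0) →
        ∀ (N : ℕ) (Φ : HardSphereFlow (Literature.Analysis.FluidPDE.Torus.geometry (Fin 3)) (hsDiameter σ N) (N + 1)),
          ∀ B : V3 → ℝ → ℝ, Measurable (fun p : V3 × ℝ => B p.1 p.2) → (∀ p e, 0 ≤ B p e) →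
            (∃ C : ℝ, ∀ p e, B p e ≤ C) →
            |∫ z, (∑ i, φ (z i).1 * g ((Real.sqrt θ)⁻¹ • ((z i).2 - u₀))) * B (configMomentum z) (configEnergy z)
                ∂(localGibbsLaw σ (fun _ => a) (fun _ => u₀) (fun _ => θ) N Φ)| ≤
              κ * C₀ * ∫ z, (((N : ℝ) + 1) *
                min 1 (‖(Real.sqrt θ)⁻¹ • ((((N : ℝ) + 1))⁻¹ • (configMomentum z) - u₀)‖ ^ 2 +
              ((θ * ((N : ℝ) + 1))⁻¹ * (2 * (configEnergy z) - 2 * inner ℝ u₀ (configMomentum z) + ((N : ℝ) + 1) * ‖u₀‖ ^ 2) / 3 - 1) ^ 2) + 1) *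
                B (configMomentum z) (configEnergy z) ∂(localGibbsLaw σ (fun _ => a) (fun _ => u₀) (fun _ => θ) N Φ) := by
  intro h1 h2
  obtain ⟨C₁, hC₁0, hC₁⟩ := h1
  obtain ⟨C₂, hC₂1, hC₂⟩ := h2
  refine ⟨3 * C₂ + C₁, by linarith, ?_⟩
  intro σ a θ u₀ hσ hσ2 ha hθ κ φ g hφ hg hφ1 hgκ horth N Φ B hBm hB0 hBC
  obtain ⟨CB, hCB⟩ := hBC
  rw [Literature.MathematicalPhysics.KineticTheory.localGibbsLaw_eq]
  haveI := Literature.MathematicalPhysics.KineticTheory.isProbabilityMeasure_localGibbsMeasure (a₀ := fun _ => a)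
    (u₀ := fun _ => u₀) (θ₀ := fun _ => θ) continuous_const continuous_const continuous_const (fun _ => ha) (fun _ => hθ) hσ2 N
  -- degenerate `κ ≤ 0`
  rcases lt_trichotomy κ 0 with hκ | rfl | hκ
  · exact absurd ((abs_nonneg _).trans (hgκ 0)) (not_le.2 hκ)
  · have hg0 : ∀ v, g v = 0 := fun v => abs_nonpos_iff.1 (hgκ v)
    simp only [hg0, mul_zero, Finset.sum_const_zero, zero_mul, integral_zero, abs_zero, le_refl]
  -- notation and the product structure
  haveI hγ1 : IsProbabilityMeasure (Measure.pi fun _ : Fin (N + 1) => stdGaussian V3) := inferInstance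
  obtain ⟨μ, hμ, hdis, hvel⟩ := exists_posLaw_integral_mul ha hθ u₀ hσ2 N
  set γ : Measure (Fin (N + 1) → V3) := Measure.pi fun _ : Fin (N + 1) => stdGaussian V3 with hγ
  set n : ℝ := (N : ℝ) + 1 with hn
  have hnpos : 0 < n := by positivity
  have hsθ : 0 < Real.sqrt θ := Real.sqrt_pos.2 hθ
  have hC₂0 : 0 ≤ C₂ := zero_le_one.trans hC₂1
  -- the test function, the shell distance and the Maxwellian average in the reduced velocities `w`
  set Bt : V3 → ℝ → ℝ := fun P' T' => B ((N + 1) • u₀ + Real.sqrt θ • P')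
    (2⁻¹ * (n * ‖u₀‖ ^ 2 + 2 * Real.sqrt θ * inner ℝ u₀ P' + θ * T')) with hBt
  set ωt : (Fin (N + 1) → V3) → ℝ := fun w =>
    min 1 (‖n⁻¹ • ∑ i, w i‖ ^ 2 + (n⁻¹ * (∑ i, ‖w i‖ ^ 2) / 3 - 1) ^ 2) with hωt
  set M : (Fin (N + 1) → V3) → ℝ := fun w => ∫ u, g (n⁻¹ • (∑ i, w i) +
    Real.sqrt ((n⁻¹ * (∑ i, ‖w i‖ ^ 2) - ‖n⁻¹ • (∑ i, w i)‖ ^ 2) / 3) • u) ∂stdGaussian V3 with hM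
  set J : Fin (N + 1) → ℝ := fun i => ∫ w, g (w i) * Bt (∑ j, w j) (∑ j, ‖w j‖ ^ 2) ∂γ with hJ
  have hBt0 : ∀ P' T', 0 ≤ Bt P' T' := fun _ _ => hB0 _ _
  have hBtC : ∀ P' T', Bt P' T' ≤ CB := fun _ _ => hCB _ _
  have hBtm : Measurable fun p : V3 × ℝ => Bt p.1 p.2 := by
    simp only [hBt]
    exact hBm.comp (f := fun p : V3 × ℝ => ((N + 1) • u₀ + Real.sqrt θ • p.1,
      2⁻¹ * (n * ‖u₀‖ ^ 2 + 2 * Real.sqrt θ * inner ℝ u₀ p.1 + θ * p.2))) (Continuous.measurable (by fun_prop))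
  have hBtw : Measurable fun w : Fin (N + 1) → V3 => Bt (∑ j, w j) (∑ j, ‖w j‖ ^ 2) :=
    hBtm.comp (f := fun w : Fin (N + 1) → V3 => (∑ j, w j, ∑ j, ‖w j‖ ^ 2)) (Continuous.measurable (by fun_prop))
  have hBtw_bd : ∀ w : Fin (N + 1) → V3, |Bt (∑ j, w j) (∑ j, ‖w j‖ ^ 2)| ≤ CB := fun w => by
    rw [abs_of_nonneg (hBt0 _ _)]; exact hBtC _ _
  have hωm : Measurable ωt := Continuous.measurable (by rw [hωt]; fun_prop)
  have hω0 : ∀ w, 0 ≤ ωt w := fun w => le_min zero_le_one (by positivity)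
  have hω1 : ∀ w, ωt w ≤ 1 := fun w => min_le_left _ _
  have hMm : Measurable M := by
    have hc : Continuous fun q : (Fin (N + 1) → V3) × V3 => g (n⁻¹ • (∑ i, q.1 i) +
        Real.sqrt ((n⁻¹ * (∑ i, ‖q.1 i‖ ^ 2) - ‖n⁻¹ • (∑ i, q.1 i)‖ ^ 2) / 3) • q.2) := by fun_prop
    exact (hc.stronglyMeasurable.integral_prod_right' (ν := stdGaussian V3)).measurable
  -- algebra of the reduction `vᵢ = u₀ + √θ wᵢ`
  have hred : ∀ (w : Fin (N + 1) → V3) (i : Fin (N + 1)), (Real.sqrt θ)⁻¹ • (u₀ + Real.sqrt θ • w i - u₀) = w i :=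
    fun w i => by rw [add_sub_cancel_left, smul_smul, inv_mul_cancel₀ hsθ.ne', one_smul]
  have hPv : ∀ w : Fin (N + 1) → V3, ∑ j, (u₀ + Real.sqrt θ • w j) = (N + 1) • u₀ + Real.sqrt θ • ∑ j, w j := fun w => by
    rw [Finset.sum_add_distrib, Finset.sum_const, Finset.card_univ, Fintype.card_fin, Finset.smul_sum]
  have hEv : ∀ w : Fin (N + 1) → V3, 2⁻¹ * ∑ j, ‖u₀ + Real.sqrt θ • w j‖ ^ 2 =
      2⁻¹ * (n * ‖u₀‖ ^ 2 + 2 * Real.sqrt θ * inner ℝ u₀ (∑ j, w j) + θ * ∑ j, ‖w j‖ ^ 2) := fun w => by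
    have hpt : ∀ j, ‖u₀ + Real.sqrt θ • w j‖ ^ 2 = ‖u₀‖ ^ 2 + 2 * Real.sqrt θ * inner ℝ u₀ (w j) + θ * ‖w j‖ ^ 2 :=
      fun j => by rw [norm_add_sq_real, inner_smul_right, norm_smul, mul_pow, Real.norm_eq_abs, sq_abs, Real.sq_sqrt hθ.le]; ring
    simp only [hpt, Finset.sum_add_distrib, Finset.sum_const, Finset.card_univ, Fintype.card_fin, nsmul_eq_mul,
      ← Finset.mul_sum, inner_sum, hn]
    push_cast
    ring
  have hP : ∀ w : Fin (N + 1) → V3, (Real.sqrt θ)⁻¹ • (n⁻¹ • (∑ i, (u₀ + Real.sqrt θ • w i)) - u₀) = n⁻¹ • ∑ i, w i := by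
    intro w
    rw [Finset.sum_add_distrib, Finset.sum_const, Finset.card_univ, Fintype.card_fin, ← Finset.smul_sum, ← Nat.cast_smul_eq_nsmul ℝ,
      smul_add, smul_smul, show (n⁻¹ * ((N + 1 : ℕ) : ℝ)) = 1 by push_cast; rw [hn]; field_simp, one_smul, add_sub_cancel_left,
      smul_smul, smul_smul]
    congr 1
    field_simp
  have hE0 : ∀ v : Fin (N + 1) → V3,
      2 * (2⁻¹ * ∑ i, ‖v i‖ ^ 2) - 2 * inner ℝ u₀ (∑ i, v i) + n * ‖u₀‖ ^ 2 = ∑ i, ‖v i - u₀‖ ^ 2 := by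
    intro v
    have hpt : ∀ i, ‖v i - u₀‖ ^ 2 = ‖v i‖ ^ 2 - 2 * inner ℝ u₀ (v i) + ‖u₀‖ ^ 2 := fun i => by
      rw [norm_sub_sq_real, real_inner_comm]
    simp only [hpt, Finset.sum_add_distrib, Finset.sum_sub_distrib, Finset.sum_const, Finset.card_univ, Fintype.card_fin,
      nsmul_eq_mul, ← Finset.mul_sum, inner_sum, hn]
    push_cast
    ring
  have hE : ∀ w : Fin (N + 1) → V3, (θ * n)⁻¹ * (2 * (2⁻¹ * ∑ i, ‖u₀ + Real.sqrt θ • w i‖ ^ 2) -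
      2 * inner ℝ u₀ (∑ i, (u₀ + Real.sqrt θ • w i)) + n * ‖u₀‖ ^ 2) = n⁻¹ * ∑ i, ‖w i‖ ^ 2 := by
    intro w
    rw [hE0]
    simp only [add_sub_cancel_left, norm_smul, mul_pow, Real.norm_eq_abs, sq_abs, Real.sq_sqrt hθ.le, ← Finset.mul_sum]
    field_simp
  -- (1) the left-hand side: `∫ F B dG = (∑ᵢ cᵢ) J₀`
  have hHm : ∀ i : Fin (N + 1), Measurable fun v : Fin (N + 1) → V3 =>
      g ((Real.sqrt θ)⁻¹ • (v i - u₀)) * B (∑ j, v j) (2⁻¹ * ∑ j, ‖v j‖ ^ 2) := fun i =>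
    (hg.measurable.comp (by fun_prop)).mul
      (hBm.comp (f := fun v : Fin (N + 1) → V3 => (∑ j, v j, 2⁻¹ * ∑ j, ‖v j‖ ^ 2)) (Continuous.measurable (by fun_prop)))
  have key : ∀ i : Fin (N + 1), ∫ z, φ (z i).1 * (g ((Real.sqrt θ)⁻¹ • ((z i).2 - u₀)) * B (configMomentum z) (configEnergy z))
      ∂(Literature.MathematicalPhysics.KineticTheory.localGibbsMeasure σ (fun _ => a) (fun _ => u₀) (fun _ => θ) N) =
      (∫ x, φ (x i) ∂μ) * J i := by
    intro i
    refine (hdis (fun x => φ (x i)) (hHm i)).trans ?_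
    congr 1
    refine integral_congr_ae (ae_of_all _ fun w => ?_)
    simp only [hBt, hred, hPv, hEv]
  have hJsymm : ∀ i, J i = J 0 := fun i => by
    simp only [hJ]
    refine Eq.trans ?_ (integral_comp_perm_pi_stdGaussian (Equiv.swap 0 i) (fun w => g (w 0) * Bt (∑ j, w j) (∑ j, ‖w j‖ ^ 2)))
    refine integral_congr_ae (ae_of_all _ fun w => ?_)
    simp only [Equiv.swap_apply_left]
    rw [Equiv.sum_comp (Equiv.swap 0 i) (fun j => w j), Equiv.sum_comp (Equiv.swap 0 i) (fun j => ‖w j‖ ^ 2)]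
  have hLHS : ∫ z, (∑ i, φ (z i).1 * g ((Real.sqrt θ)⁻¹ • ((z i).2 - u₀))) * B (configMomentum z) (configEnergy z)
      ∂(Literature.MathematicalPhysics.KineticTheory.localGibbsMeasure σ (fun _ => a) (fun _ => u₀) (fun _ => θ) N) =
      (∑ i : Fin (N + 1), ∫ x, φ (x i) ∂μ) * J 0 := by
    have hint : ∀ i : Fin (N + 1), Integrable (fun z : Config (N + 1) (Fin 3) T3 =>
        φ (z i).1 * (g ((Real.sqrt θ)⁻¹ • ((z i).2 - u₀)) * B (configMomentum z) (configEnergy z)))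
        (Literature.MathematicalPhysics.KineticTheory.localGibbsMeasure σ (fun _ => a) (fun _ => u₀) (fun _ => θ) N) := fun i =>
      integrable_mul_of_abs_le (hφ.measurable.comp (measurable_pi_apply i).fst)
        ((hg.measurable.comp (by fun_prop)).mul
          (hBm.comp (f := fun z : Config (N + 1) (Fin 3) T3 => (configMomentum z, configEnergy z)) (Continuous.measurable (by fun_prop))))
        (fun z => hφ1 _) (fun z => by
          rw [abs_mul, abs_of_nonneg (hB0 _ _)]
          exact mul_le_mul (hgκ _) (hCB _ _) (hB0 _ _) hκ.le)
    calc _ = ∫ z, ∑ i, φ (z i).1 * (g ((Real.sqrt θ)⁻¹ • ((z i).2 - u₀)) * B (configMomentum z) (configEnergy z))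
          ∂(Literature.MathematicalPhysics.KineticTheory.localGibbsMeasure σ (fun _ => a) (fun _ => u₀) (fun _ => θ) N) := by
          simp_rw [Finset.sum_mul, mul_assoc]
      _ = ∑ i, (∫ x, φ (x i) ∂μ) * J i := by
          rw [integral_finsetSum _ fun i _ => hint i]
          exact Finset.sum_congr rfl fun i _ => key i
      _ = ∑ i : Fin (N + 1), (∫ x, φ (x i) ∂μ) * J 0 := Finset.sum_congr rfl fun i _ => by rw [hJsymm i]
      _ = _ := by rw [Finset.sum_mul]
  have hc : |∑ i : Fin (N + 1), ∫ x, φ (x i) ∂μ| ≤ n := by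
    refine (Finset.abs_sum_le_sum_abs _ _).trans ?_
    calc ∑ i : Fin (N + 1), |∫ x, φ (x i) ∂μ| ≤ ∑ _i : Fin (N + 1), (1 : ℝ) := Finset.sum_le_sum fun i _ => by
            have h := norm_integral_le_of_norm_le_const (μ := μ) (f := fun x => φ (x i)) (C := 1)
              (ae_of_all _ fun x => by rw [Real.norm_eq_abs]; exact hφ1 _)
            rwa [probReal_univ, mul_one, Real.norm_eq_abs] at h
      _ = n := by simp [hn]
  -- (2) hypothesis 1: the Maxwellian average replaces `g(w₀)`
  have step1 : |∫ w, (g (w 0) - M w) * Bt (∑ j, w j) (∑ j, ‖w j‖ ^ 2) ∂γ| ≤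
      κ * (C₁ / n * ∫ w, Bt (∑ j, w j) (∑ j, ‖w j‖ ^ 2) ∂γ) := by
    have h := hC₁ N (fun v => κ⁻¹ * g v) (measurable_const.mul hg.measurable)
      (fun v => by rw [abs_mul, abs_of_pos (inv_pos.2 hκ), inv_mul_le_iff₀ hκ, mul_one]; exact hgκ v) Bt hBtm hBt0 ⟨CB, hBtC⟩
    rw [← inv_mul_le_iff₀ hκ, ← abs_of_pos (inv_pos.2 hκ), ← abs_mul, ← integral_const_mul]
    refine Eq.trans_le ?_ h
    congr 1
    refine integral_congr_ae (ae_of_all _ fun w => ?_)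
    simp only [hM]
    rw [integral_const_mul]
    ring
  -- (3) hypothesis 2 and the elementary comparison: `|M_g| ≤ 3 κ C₂ ω̃`
  have step2 : ∀ w, |M w| ≤ κ * C₂ * (3 * ωt w) := fun w => by
    have hx := norm_sq_mean_le w
    rw [← hn] at hx
    have hs : 0 ≤ (n⁻¹ * (∑ i, ‖w i‖ ^ 2) - ‖n⁻¹ • (∑ i, w i)‖ ^ 2) / 3 := by linarith
    refine (hC₂ κ g hg hgκ horth _ _ hs).trans ?_
    exact mul_le_mul_of_nonneg_left (min_shell_le (sq_nonneg _)) (mul_nonneg hκ.le hC₂0)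
  have hMbd : ∀ w, |M w| ≤ κ * C₂ * (3 * 1) := fun w =>
    (step2 w).trans (mul_le_mul_of_nonneg_left (mul_le_mul_of_nonneg_left (hω1 w) zero_le_three) (mul_nonneg hκ.le hC₂0))
  -- integrability under `γ`
  have hBt_int : Integrable (fun w => Bt (∑ j, w j) (∑ j, ‖w j‖ ^ 2)) γ :=
    Integrable.of_bound hBtw.aestronglyMeasurable CB (ae_of_all _ fun w => by rw [Real.norm_eq_abs]; exact hBtw_bd w)
  have hωBt_int : Integrable (fun w => ωt w * Bt (∑ j, w j) (∑ j, ‖w j‖ ^ 2)) γ :=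
    integrable_mul_of_abs_le hωm hBtw (fun w => by rw [abs_of_nonneg (hω0 w)]; exact hω1 w) hBtw_bd
  have hMBt_int : Integrable (fun w => M w * Bt (∑ j, w j) (∑ j, ‖w j‖ ^ 2)) γ :=
    integrable_mul_of_abs_le hMm hBtw hMbd hBtw_bd
  have hsub_int : Integrable (fun w => (g (w 0) - M w) * Bt (∑ j, w j) (∑ j, ‖w j‖ ^ 2)) γ :=
    integrable_mul_of_abs_le ((hg.measurable.comp (measurable_pi_apply 0)).sub hMm) hBtw
      (fun w => (abs_sub _ _).trans (add_le_add (hgκ _) (hMbd w))) hBtw_bd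
  have step3 : |∫ w, M w * Bt (∑ j, w j) (∑ j, ‖w j‖ ^ 2) ∂γ| ≤
      κ * C₂ * (3 * ∫ w, ωt w * Bt (∑ j, w j) (∑ j, ‖w j‖ ^ 2) ∂γ) := by
    calc |∫ w, M w * Bt (∑ j, w j) (∑ j, ‖w j‖ ^ 2) ∂γ| ≤ ∫ w, |M w * Bt (∑ j, w j) (∑ j, ‖w j‖ ^ 2)| ∂γ :=
          abs_integral_le_integral_abs
      _ ≤ ∫ w, κ * C₂ * (3 * (ωt w * Bt (∑ j, w j) (∑ j, ‖w j‖ ^ 2))) ∂γ := by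
          refine integral_mono_of_nonneg (ae_of_all _ fun w => abs_nonneg _) ((hωBt_int.const_mul 3).const_mul (κ * C₂))
            (ae_of_all _ fun w => ?_)
          dsimp only
          rw [abs_mul, abs_of_nonneg (hBt0 _ _)]
          calc |M w| * Bt (∑ j, w j) (∑ j, ‖w j‖ ^ 2) ≤ κ * C₂ * (3 * ωt w) * Bt (∑ j, w j) (∑ j, ‖w j‖ ^ 2) :=
                mul_le_mul_of_nonneg_right (step2 w) (hBt0 _ _)
            _ = _ := by ring
      _ = κ * C₂ * (3 * ∫ w, ωt w * Bt (∑ j, w j) (∑ j, ‖w j‖ ^ 2) ∂γ) := by rw [integral_const_mul, integral_const_mul]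
  have hJ0 : J 0 = ∫ w, (g (w 0) - M w) * Bt (∑ j, w j) (∑ j, ‖w j‖ ^ 2) ∂γ + ∫ w, M w * Bt (∑ j, w j) (∑ j, ‖w j‖ ^ 2) ∂γ := by
    rw [hJ, ← integral_add hsub_int hMBt_int]
    exact integral_congr_ae (ae_of_all _ fun w => by ring)
  have hJ0_bd : |J 0| ≤ κ * (C₁ / n * ∫ w, Bt (∑ j, w j) (∑ j, ‖w j‖ ^ 2) ∂γ) +
      κ * C₂ * (3 * ∫ w, ωt w * Bt (∑ j, w j) (∑ j, ‖w j‖ ^ 2) ∂γ) := by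
    rw [hJ0]
    exact (abs_add_le _ _).trans (add_le_add step1 step3)
  -- (4) the right-hand side in the reduced velocities
  have hH2m : Measurable fun v : Fin (N + 1) → V3 => (n * min 1 (‖(Real.sqrt θ)⁻¹ • (n⁻¹ • (∑ i, v i) - u₀)‖ ^ 2 +
      ((θ * n)⁻¹ * (2 * (2⁻¹ * ∑ i, ‖v i‖ ^ 2) - 2 * inner ℝ u₀ (∑ i, v i) + n * ‖u₀‖ ^ 2) / 3 - 1) ^ 2) + 1) *
      B (∑ i, v i) (2⁻¹ * ∑ i, ‖v i‖ ^ 2) :=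
    (Continuous.measurable (by fun_prop)).mul
      (hBm.comp (f := fun v : Fin (N + 1) → V3 => (∑ j, v j, 2⁻¹ * ∑ j, ‖v j‖ ^ 2)) (Continuous.measurable (by fun_prop)))
  have hRHS : ∫ z, (n * min 1 (‖(Real.sqrt θ)⁻¹ • (n⁻¹ • (configMomentum z) - u₀)‖ ^ 2 +
      ((θ * n)⁻¹ * (2 * (configEnergy z) - 2 * inner ℝ u₀ (configMomentum z) + n * ‖u₀‖ ^ 2) / 3 - 1) ^ 2) + 1) *
        B (configMomentum z) (configEnergy z)
        ∂(Literature.MathematicalPhysics.KineticTheory.localGibbsMeasure σ (fun _ => a) (fun _ => u₀) (fun _ => θ) N) =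
      ∫ w, (n * ωt w + 1) * Bt (∑ j, w j) (∑ j, ‖w j‖ ^ 2) ∂γ := by
    refine (hvel hH2m).trans ?_
    refine integral_congr_ae (ae_of_all _ fun w => ?_)
    simp only [hωt, hBt]
    rw [hP w, hE w, hPv w, hEv w]
  have hsplit : ∫ w, (n * ωt w + 1) * Bt (∑ j, w j) (∑ j, ‖w j‖ ^ 2) ∂γ =
      n * ∫ w, ωt w * Bt (∑ j, w j) (∑ j, ‖w j‖ ^ 2) ∂γ + ∫ w, Bt (∑ j, w j) (∑ j, ‖w j‖ ^ 2) ∂γ := by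
    rw [← integral_const_mul, ← integral_add (hωBt_int.const_mul n) hBt_int]
    exact integral_congr_ae (ae_of_all _ fun w => by ring)
  -- (5) collect
  rw [hLHS, hRHS, hsplit, abs_mul]
  have hX0 : 0 ≤ ∫ w, Bt (∑ j, w j) (∑ j, ‖w j‖ ^ 2) ∂γ := integral_nonneg fun w => hBt0 _ _
  have hY0 : 0 ≤ ∫ w, ωt w * Bt (∑ j, w j) (∑ j, ‖w j‖ ^ 2) ∂γ := integral_nonneg fun w => mul_nonneg (hω0 w) (hBt0 _ _)
  set X : ℝ := ∫ w, Bt (∑ j, w j) (∑ j, ‖w j‖ ^ 2) ∂γ with hX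
  set Y : ℝ := ∫ w, ωt w * Bt (∑ j, w j) (∑ j, ‖w j‖ ^ 2) ∂γ with hY
  have hn0 : n ≠ 0 := hnpos.ne'
  calc |∑ i : Fin (N + 1), ∫ x, φ (x i) ∂μ| * |J 0| ≤ n * (κ * (C₁ / n * X) + κ * C₂ * (3 * Y)) :=
        mul_le_mul hc hJ0_bd (abs_nonneg _) hnpos.le
    _ = κ * C₁ * X + 3 * κ * C₂ * n * Y := by field_simp
    _ ≤ κ * (3 * C₂ + C₁) * (n * Y + X) := by
        nlinarith [mul_nonneg (mul_nonneg hκ.le hC₂0) hX0, mul_nonneg (mul_nonneg (mul_nonneg hκ.le hC₁0) hnpos.le) hY0]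

end Summit.AtomisticToContinuum.HydrodynamicLimit.Theorems.AlmostInvariantDuality

end
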